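import Literature.Probability.Percolation.LandedAltPivotalCut
import Literature.Probability.Percolation.HexConvexPaths
import HarnessLib

/-!
# Geometry of a ball at the boundary of the hexagon: the paint and the unpainted exterior are connected

Topic `Literature/Probability/Percolation`; family `crit-perc`. PROOFS ONLY (no definition, no
named fact). Lattice geometry for the boundary layer of the pivotal analysis of Werner's
Lemma 6.3 through the landed alternating event (`LandedAltPivotalCut.lean`; W. Werner, PCMI 2009,
Lecture 6, §5 and proof of Lemma 6.2, boundary contributions).

Around a pivotal site `v` close to `∂Λ_N` the cut-point lemma is applied in a ball `v + Λ_D` that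
sticks out of `Λ_N`, to the configuration in which the cone beyond the landing side `i` of the arm
through `v` is painted (`sidePaint N i`) and the rest of the exterior is not. To read genuine arms
of `Λ_N` off the resulting alternating arms one needs that, inside the punctured ball, **the paint
is connected** and **the unpainted exterior is connected**, so that two arms of the same colour
cannot both leave `Λ_N` (they would be joined outside, against the cluster form of `altFourArm`).
Both regions are unions of hexagonally convex regions (`HexConvexPaths.lean`) after rotating the
landing side to side `0`:

* `triRotIsoPow_apply_add`, `triRotIsoPow_apply_sub`, `triRotIsoPow_six_sub_apply`,
  `triRotIsoPow_sub_six_apply` — the rotations are additive; `ρ^{6-i}` inverts `ρ^i` (`i ≤ 6`);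
  `mem_sidePaint_iff_rot` — `z ∈ sidePaint N i ↔ ρ^{6-i} z` lies beyond `Λ_N` in the open cone
  over side `0`;
* **`pathIn_paint_ball`** — two sites `u, u'` with `u + v, u' + v ∈ sidePaint N i` and
  `|u|, |u'| ≤ D` (`|v| ≤ N`) are joined by a path of such sites with `1 ≤ |·| ≤ D` (in the
  rotated frame the region is `{x₀ ≥ N+1, x₁ ≤ -1, x₀ + x₁ ≥ 1} ∩ Λ_D(v')`, hexagonally convex);
* **`pathIn_exterior_ball`** — two sites `e, e'` with `|e + v| = |e' + v| = N + 1`,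
  `e + v, e' + v ∉ sidePaint N i`, `|e|, |e'| ≤ D`, `4D + 1 ≤ N + 1`, `|v| ≤ N`, are joined by a
  path of sites `u` with `N < |u + v|`, `u + v ∉ sidePaint N i`, `1 ≤ |u| ≤ D`: in the rotated
  frame `e + v`, `e' + v` lie on closed sides `a, a' ≠ 0` of `∂Λ_{N+1}` (`exterior_pathIn_frame0`);
  sides at distance `≥ 2` apart are `≥ N + 1 > 2D` apart; equal or adjacent sides are handled by
  the hexagonally convex regions `Λ_D(v') ∩ {beyond side a}` (with the half-plane `x₁ ≥ 0`, resp.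
  `x₀ + x₁ ≤ 0`, removed from the paint for `a = 1, 5`), two adjacent ones sharing the hub
  `v' + D · corner(a, a+1)`.

## References

* W. Werner, *Lectures on two-dimensional critical percolation*, IAS/Park City Math. Ser. 16
  (2009), Lecture 6, proof of Lemma 6.2 (boundary contributions) and §5 [WernerPCMI2009].
* P. Nolin, Near-critical percolation in two dimensions, *Electron. J. Probab.* 13 (2008), §4.6,
  §6.2 [Nolin2008].

Tree: `sidePaint`, `lt_triNorm_of_mem_sidePaint` (`LandedAltPivotalCut.lean`), `hexConvex`,
`mem_hexConvex`, `pathIn_hexConvex` (`HexConvexPaths.lean`), `triRotIsoPow`, `triRot60`,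
`triRotIsoPow_add_apply`, `triRotIsoPow_add_six_apply`, `rot_apply_formula`, `triNorm_rot`
(`TriAnnulusCircuit.lean`, `ArmSeparationRotate.lean`), `triNorm_le_iff_lin`, `le_triNorm_iff_lin`,
`triNorm_add_le`, `triNorm_neg`, `triShiftIso`, `pathIn_map_iso`, `PathIn` API.
-/

noncomputable section

open Set

namespace Literature.Probability.Percolation

open LatticeModels

/-! ### The rotations are linear; `ρ^{6-i}` inverts `ρ^i` -/

/-- `triRot60` is additive. [folklore] -/
theorem triRot60_add (a b : Site 2) : triRot60 (a + b) = triRot60 a + triRot60 b := by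
  ext i; fin_cases i <;> simp [triRot60_apply_zero, triRot60_apply_one] <;> ring

/-- The rotations `ρ^n` are additive. [folklore] -/
theorem triRotIsoPow_apply_add (n : ℕ) (a b : Site 2) :
    triRotIsoPow n (a + b) = triRotIsoPow n a + triRotIsoPow n b := by
  induction n with
  | zero => simp only [triRotIsoPow_zero_apply]
  | succ n ih => rw [triRotIsoPow_succ_apply, triRotIsoPow_succ_apply, triRotIsoPow_succ_apply, ih, triRot60_add]

/-- The rotations map `0` to `0`. [folklore] -/
theorem triRotIsoPow_apply_zero' (n : ℕ) : triRotIsoPow n (0 : Site 2) = 0 := by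
  have h := triRotIsoPow_apply_add n (0 : Site 2) 0
  rw [add_zero] at h
  have : triRotIsoPow n (0 : Site 2) + triRotIsoPow n 0 - triRotIsoPow n 0 = triRotIsoPow n 0 - triRotIsoPow n 0 := by
    rw [← h]
  simpa using this

/-- The rotations commute with negation. [folklore] -/
theorem triRotIsoPow_apply_neg (n : ℕ) (a : Site 2) : triRotIsoPow n (-a) = -triRotIsoPow n a := by
  have h := triRotIsoPow_apply_add n a (-a)
  rw [add_neg_cancel, triRotIsoPow_apply_zero'] at h
  exact (neg_eq_of_add_eq_zero_right h.symm).symm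

/-- The rotations are compatible with subtraction. [folklore] -/
theorem triRotIsoPow_apply_sub (n : ℕ) (a b : Site 2) :
    triRotIsoPow n (a - b) = triRotIsoPow n a - triRotIsoPow n b := by
  rw [sub_eq_add_neg, triRotIsoPow_apply_add, triRotIsoPow_apply_neg, ← sub_eq_add_neg]

/-- `ρ^i ∘ ρ^{6-i} = id` (`i ≤ 6`). [folklore] -/
theorem triRotIsoPow_six_sub_apply {i : ℕ} (hi : i ≤ 6) (z : Site 2) :
    triRotIsoPow i (triRotIsoPow (6 - i) z) = z := by
  rw [← triRotIsoPow_add_apply, show 6 - i + i = 0 + 6 by omega, triRotIsoPow_add_six_apply,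
    triRotIsoPow_zero_apply]

/-- `ρ^{6-i} ∘ ρ^i = id` (`i ≤ 6`). [folklore] -/
theorem triRotIsoPow_sub_six_apply {i : ℕ} (hi : i ≤ 6) (z : Site 2) :
    triRotIsoPow (6 - i) (triRotIsoPow i z) = z := by
  rw [← triRotIsoPow_add_apply, show i + (6 - i) = 0 + 6 by omega, triRotIsoPow_add_six_apply,
    triRotIsoPow_zero_apply]

/-- **The paint in the rotated frame**: `z ∈ sidePaint N i` iff `ρ^{6-i} z` lies beyond `Λ_N` in
the open cone over side `0` (`i ≤ 6`). [folklore] -/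
theorem mem_sidePaint_iff_rot {N i : ℕ} (hi : i ≤ 6) {z : Site 2} :
    z ∈ sidePaint N i ↔ ((N : ℤ) < triNorm (triRotIsoPow (6 - i) z) ∧
      (0 < (triRotIsoPow (6 - i) z) 0 ∧ (triRotIsoPow (6 - i) z) 1 < 0 ∧
        0 < (triRotIsoPow (6 - i) z) 0 + (triRotIsoPow (6 - i) z) 1)) := by
  constructor
  · rintro ⟨s, hs, rfl⟩
    rwa [triRotIsoPow_sub_six_apply hi]
  · intro h
    exact ⟨triRotIsoPow (6 - i) z, h, triRotIsoPow_six_sub_apply hi z⟩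

/-! ### The frame of the landing side -/

section Frame

variable {N i D : ℕ} {v : Site 2}

/-- The graph isomorphism `s ↦ ρ^i (s - ρ^{6-i} v)` from the rotated frame centred at
`v' = ρ^{6-i} v` back to the original coordinates centred at `v`. [folklore] -/
def frameBack (i : ℕ) (v : Site 2) : triGraph ≃g triGraph :=
  (triShiftIso (-(triRotIsoPow (6 - i) v))).trans (triRotIsoPow i)

/-- `frameBack` in coordinates. [folklore] -/
theorem frameBack_apply (i : ℕ) (v s : Site 2) :
    frameBack i v s = triRotIsoPow i (s - triRotIsoPow (6 - i) v) := by
  show triRotIsoPow i (triShiftIso (-(triRotIsoPow (6 - i) v)) s) = _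
  rw [triShiftIso_apply, ← sub_eq_add_neg]

/-- `frameBack i v s + v = ρ^i s` (`i ≤ 6`). [folklore] -/
theorem frameBack_add (hi : i ≤ 6) (s : Site 2) : frameBack i v s + v = triRotIsoPow i s := by
  rw [frameBack_apply, triRotIsoPow_apply_sub, triRotIsoPow_six_sub_apply hi, sub_add_cancel]

/-- `|frameBack i v s| = |s - ρ^{6-i} v|`. [folklore] -/
theorem triNorm_frameBack (s : Site 2) :
    triNorm (frameBack i v s) = triNorm (s - triRotIsoPow (6 - i) v) := by
  rw [frameBack_apply, triNorm_rot]

/-- The inverse direction: `frameBack i v (ρ^{6-i} (u + v)) = u` (`i ≤ 6`). [folklore] -/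
theorem frameBack_rot (hi : i ≤ 6) (u : Site 2) :
    frameBack i v (triRotIsoPow (6 - i) (u + v)) = u := by
  rw [frameBack_apply, ← triRotIsoPow_apply_sub, add_sub_cancel_right, triRotIsoPow_six_sub_apply hi]

/-- **The paint inside the punctured ball is connected.** If `u + v` and `u' + v` are painted
(`sidePaint N i`, `i ≤ 6`), `|u|, |u'| ≤ D` and `|v| ≤ N`, then `u` and `u'` are joined by a path
of sites `z` with `z + v` painted and `1 ≤ |z| ≤ D` (in the rotated frame the painted part of the
ball is the hexagonally convex region `{x₀ ≥ N + 1, x₁ ≤ -1, x₀ + x₁ ≥ 1} ∩ Λ_D(v')`). [folklore] -/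
theorem pathIn_paint_ball (hi : i ≤ 6) (hvN : triNorm v ≤ N) {u u' : Site 2}
    (hu : u + v ∈ sidePaint N i) (hu' : u' + v ∈ sidePaint N i) (hD : triNorm u ≤ D)
    (hD' : triNorm u' ≤ D) :
    PathIn triGraph {z : Site 2 | z + v ∈ sidePaint N i ∧ 1 ≤ triNorm z ∧ triNorm z ≤ D} u u' := by
  set v' := triRotIsoPow (6 - i) v with hv'
  set s := triRotIsoPow (6 - i) (u + v) with hs
  set s' := triRotIsoPow (6 - i) (u' + v) with hs'
  have hvn : triNorm v' = triNorm v := triNorm_rot _ _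
  have hsv : s - v' = triRotIsoPow (6 - i) u := by rw [hs, hv', ← triRotIsoPow_apply_sub, add_sub_cancel_right]
  have hsv' : s' - v' = triRotIsoPow (6 - i) u' := by rw [hs', hv', ← triRotIsoPow_apply_sub, add_sub_cancel_right]
  have hsD : triNorm (s - v') ≤ D := by rw [hsv, triNorm_rot]; exact hD
  have hsD' : triNorm (s' - v') ≤ D := by rw [hsv', triNorm_rot]; exact hD'
  obtain ⟨hsN, hsc⟩ := (mem_sidePaint_iff_rot hi).1 hu
  obtain ⟨hsN', hsc'⟩ := (mem_sidePaint_iff_rot hi).1 hu'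
  rw [← hs] at hsN hsc
  rw [← hs'] at hsN' hsc'
  have hs0 : triNorm s = s 0 := triNorm_eq_apply_zero hsc.2.1.le hsc.2.2.le
  have hs0' : triNorm s' = s' 0 := triNorm_eq_apply_zero hsc'.2.1.le hsc'.2.2.le
  -- the hexagonally convex region in the rotated frame
  set c : Fin 6 → ℤ := ![D + v' 0, min (D - v' 0) (-(N + 1)), min (D + v' 1) (-1), D - v' 1,
    D + (v' 0 + v' 1), min (D - (v' 0 + v' 1)) (-1)] with hc
  have hmemK : ∀ {z : Site 2}, triNorm (z - v') ≤ D → (N : ℤ) < z 0 → z 1 < 0 → 0 < z 0 + z 1 →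
      z ∈ hexConvex c := by
    intro z hz h0 h1 h2
    have hz' := triNorm_le_iff_lin.1 hz
    simp only [Pi.sub_apply] at hz'
    simp only [mem_hexConvex, hc, Matrix.cons_val_zero, Matrix.cons_val_one, Matrix.cons_val,
      le_min_iff]
    omega
  have hsK : s ∈ hexConvex c := hmemK hsD (by rw [← hs0]; exact hsN) hsc.2.1 hsc.2.2
  have hsK' : s' ∈ hexConvex c := hmemK hsD' (by rw [← hs0']; exact hsN') hsc'.2.1 hsc'.2.2
  have hKsub : ∀ z ∈ hexConvex c, triNorm (z - v') ≤ D ∧ ((N : ℤ) < triNorm z ∧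
      (0 < z 0 ∧ z 1 < 0 ∧ 0 < z 0 + z 1)) := by
    intro z hz
    simp only [mem_hexConvex, hc, Matrix.cons_val_zero, Matrix.cons_val_one, Matrix.cons_val,
      le_min_iff] at hz
    have hcone : 0 < z 0 ∧ z 1 < 0 ∧ 0 < z 0 + z 1 := ⟨by omega, by omega, by omega⟩
    refine ⟨?_, ?_, hcone⟩
    · rw [triNorm_le_iff_lin]; simp only [Pi.sub_apply]; omega
    · rw [triNorm_eq_apply_zero hcone.2.1.le hcone.2.2.le]; omega
  -- back to the original frame
  have hpath := pathIn_map_iso (frameBack i v) (pathIn_hexConvex c hsK hsK')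
  rw [hs, hs', frameBack_rot hi, frameBack_rot hi] at hpath
  refine hpath.mono ?_
  rintro z ⟨w, hw, rfl⟩
  obtain ⟨hwD, hwP⟩ := hKsub w hw
  refine ⟨?_, ?_, by rw [triNorm_frameBack]; exact hwD⟩
  · rw [frameBack_add hi, mem_sidePaint_iff_rot hi, triRotIsoPow_sub_six_apply hi]
    exact hwP
  · rw [triNorm_frameBack, ← hv']
    have h1 := triNorm_add_le (w - v') v'
    rw [sub_add_cancel] at h1
    have : (N : ℤ) < triNorm w := hwP.1
    omega

/-! ### The unpainted exterior, in the frame of side `0` -/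

/-- **Two sites of `∂Λ_M` off the open side `0`, within `D` of a site of `Λ_{M-1}`, are joined
inside `{|·| ≥ M} ∖ (open cone over side 0)` within distance `D` of that site** (`4D + 1 ≤ M`).
Case analysis over the closed sides `1, …, 5` of `∂Λ_M` carrying the two sites: sides two apart
are `≥ M > 2D` apart; one side, or two adjacent sides with the hub `v' + D · corner`, are covered
by hexagonally convex regions (`pathIn_hexConvex`). [folklore] -/
theorem exterior_pathIn_frame0 {M D : ℕ} {v' s s' : Site 2} (hMD : 4 * D + 1 ≤ M)
    (hv' : triNorm v' + 1 ≤ M) (hs : triNorm s = M) (hs' : triNorm s' = M)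
    (hsc : ¬ (0 < s 0 ∧ s 1 < 0 ∧ 0 < s 0 + s 1)) (hsc' : ¬ (0 < s' 0 ∧ s' 1 < 0 ∧ 0 < s' 0 + s' 1))
    (hd : triNorm (s - v') ≤ D) (hd' : triNorm (s' - v') ≤ D) :
    PathIn triGraph {z : Site 2 | (M : ℤ) ≤ triNorm z ∧ ¬ (0 < z 0 ∧ z 1 < 0 ∧ 0 < z 0 + z 1) ∧
      triNorm (z - v') ≤ D} s s' := by
  -- linear facts
  have hsle := triNorm_le_iff_lin.1 hs.le
  have hsle' := triNorm_le_iff_lin.1 hs'.le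
  have hsge := le_triNorm_iff_lin.1 hs.ge
  have hsge' := le_triNorm_iff_lin.1 hs'.ge
  have hdl := triNorm_le_iff_lin.1 hd
  have hdl' := triNorm_le_iff_lin.1 hd'
  have hvl := triNorm_le_iff_lin.1 (le_refl (triNorm v'))
  simp only [Pi.sub_apply] at hdl hdl'
  set T : Set (Site 2) := {z : Site 2 | (M : ℤ) ≤ triNorm z ∧ ¬ (0 < z 0 ∧ z 1 < 0 ∧ 0 < z 0 + z 1) ∧
      triNorm (z - v') ≤ D} with hT
  -- membership in `T` from linear facts
  have memT : ∀ z : Site 2, ((M : ℤ) ≤ z 0 + z 1 ∨ (M : ℤ) ≤ z 1 ∨ (M : ℤ) ≤ -z 0 ∨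
      (M : ℤ) ≤ -(z 0 + z 1) ∨ (M : ℤ) ≤ -z 1) → ¬ (0 < z 0 ∧ z 1 < 0 ∧ 0 < z 0 + z 1) →
      (z 0 - v' 0 ≤ D ∧ -(z 0 - v' 0) ≤ D ∧ z 1 - v' 1 ≤ D ∧ -(z 1 - v' 1) ≤ D ∧
        z 0 - v' 0 + (z 1 - v' 1) ≤ D ∧ -(z 0 - v' 0 + (z 1 - v' 1)) ≤ D) → z ∈ T := by
    intro z h1 h2 h3
    refine ⟨le_triNorm_iff_lin.2 (by omega), h2, ?_⟩
    rw [triNorm_le_iff_lin]; simpa only [Pi.sub_apply] using h3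
  -- the five regions beyond the closed sides `1, …, 5` of `∂Λ_M` inside the ball
  -- (`a = 1`: also `x₁ ≥ 0`; `a = 5`: also `x₀ + x₁ ≤ 0`)
  set c₁ : Fin 6 → ℤ := ![D + v' 0, D - v' 0, D + v' 1, min (D - v' 1) 0, D + (v' 0 + v' 1),
    min (D - (v' 0 + v' 1)) (-M)] with hc₁
  set c₂ : Fin 6 → ℤ := ![D + v' 0, D - v' 0, D + v' 1, min (D - v' 1) (-M), D + (v' 0 + v' 1),
    D - (v' 0 + v' 1)] with hc₂
  set c₃ : Fin 6 → ℤ := ![min (D + v' 0) (-M), D - v' 0, D + v' 1, D - v' 1, D + (v' 0 + v' 1),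
    D - (v' 0 + v' 1)] with hc₃
  set c₄ : Fin 6 → ℤ := ![D + v' 0, D - v' 0, D + v' 1, D - v' 1, min (D + (v' 0 + v' 1)) (-M),
    D - (v' 0 + v' 1)] with hc₄
  set c₅ : Fin 6 → ℤ := ![D + v' 0, D - v' 0, min (D + v' 1) (-M), D - v' 1, min (D + (v' 0 + v' 1)) 0,
    D - (v' 0 + v' 1)] with hc₅
  have sub₁ : hexConvex c₁ ⊆ T := by
    intro z hz
    simp only [mem_hexConvex, hc₁, Matrix.cons_val_zero, Matrix.cons_val_one, Matrix.cons_val,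
      le_min_iff] at hz
    exact memT z (by omega) (by omega) (by omega)
  have sub₂ : hexConvex c₂ ⊆ T := by
    intro z hz
    simp only [mem_hexConvex, hc₂, Matrix.cons_val_zero, Matrix.cons_val_one, Matrix.cons_val,
      le_min_iff] at hz
    exact memT z (by omega) (by omega) (by omega)
  have sub₃ : hexConvex c₃ ⊆ T := by
    intro z hz
    simp only [mem_hexConvex, hc₃, Matrix.cons_val_zero, Matrix.cons_val_one, Matrix.cons_val,
      le_min_iff] at hz
    exact memT z (by omega) (by omega) (by omega)
  have sub₄ : hexConvex c₄ ⊆ T := by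
    intro z hz
    simp only [mem_hexConvex, hc₄, Matrix.cons_val_zero, Matrix.cons_val_one, Matrix.cons_val,
      le_min_iff] at hz
    exact memT z (by omega) (by omega) (by omega)
  have sub₅ : hexConvex c₅ ⊆ T := by
    intro z hz
    simp only [mem_hexConvex, hc₅, Matrix.cons_val_zero, Matrix.cons_val_one, Matrix.cons_val,
      le_min_iff] at hz
    exact memT z (by omega) (by omega) (by omega)
  -- membership tests
  have mem : ∀ (c : Fin 6 → ℤ) (z : Site 2), (z 0 ≤ c 0 ∧ -z 0 ≤ c 1 ∧ z 1 ≤ c 2 ∧ -z 1 ≤ c 3 ∧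
      z 0 + z 1 ≤ c 4 ∧ -(z 0 + z 1) ≤ c 5) → z ∈ hexConvex c := fun c z h => h
  -- which closed sides carry `s` and `s'` (not the open side `0`)
  have side : ∀ z : Site 2, triNorm z = M → ¬ (0 < z 0 ∧ z 1 < 0 ∧ 0 < z 0 + z 1) →
      (z 0 + z 1 = M ∧ 0 ≤ z 0 ∧ 0 ≤ z 1) ∨ (z 1 = M ∧ z 0 ≤ 0 ∧ -(M : ℤ) ≤ z 0) ∨
      (z 0 = -(M : ℤ) ∧ 0 ≤ z 1 ∧ z 1 ≤ M) ∨ (z 0 + z 1 = -(M : ℤ) ∧ z 0 ≤ 0 ∧ z 1 ≤ 0) ∨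
      (z 1 = -(M : ℤ) ∧ 0 ≤ z 0 ∧ z 0 ≤ M) := by
    intro z hz hzc
    have h1 := triNorm_le_iff_lin.1 hz.le
    have h2 := le_triNorm_iff_lin.1 hz.ge
    omega
  rcases side s hs hsc with h | h | h | h | h <;> rcases side s' hs' hsc' with h' | h' | h' | h' | h'
  · -- both on side 1
    have ms : s ∈ hexConvex c₁ := mem _ s (by simp only [hc₁, Matrix.cons_val_zero, Matrix.cons_val_one, Matrix.cons_val, le_min_iff]; omega)
    have ms' : s' ∈ hexConvex c₁ := mem _ s' (by simp only [hc₁, Matrix.cons_val_zero, Matrix.cons_val_one, Matrix.cons_val, le_min_iff]; omega)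
    exact (pathIn_hexConvex _ ms ms').mono sub₁
  · -- sides 1 and 2: hub `v' + (0, D)`
    set q : Site 2 := ![v' 0 + (0), v' 1 + (D)] with hq
    have hq0 : q 0 = v' 0 + (0) := by simp [hq]
    have hq1 : q 1 = v' 1 + (D) := by simp [hq]
    have ms : s ∈ hexConvex c₁ := mem _ s (by simp only [hc₁, Matrix.cons_val_zero, Matrix.cons_val_one, Matrix.cons_val, le_min_iff]; omega)
    have mq : q ∈ hexConvex c₁ := mem _ q (by rw [hq0, hq1]; simp only [hc₁, Matrix.cons_val_zero, Matrix.cons_val_one, Matrix.cons_val, le_min_iff]; omega)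
    have mq' : q ∈ hexConvex c₂ := mem _ q (by rw [hq0, hq1]; simp only [hc₂, Matrix.cons_val_zero, Matrix.cons_val_one, Matrix.cons_val, le_min_iff]; omega)
    have ms' : s' ∈ hexConvex c₂ := mem _ s' (by simp only [hc₂, Matrix.cons_val_zero, Matrix.cons_val_one, Matrix.cons_val, le_min_iff]; omega)
    exact ((pathIn_hexConvex _ ms mq).mono sub₁).trans ((pathIn_hexConvex _ mq' ms').mono sub₂)
  · -- sides 1 and 3 are too far apart
    exfalso; omega
  · -- sides 1 and 4 are too far apart
    exfalso; omega
  · -- sides 1 and 5 are too far apart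
    exfalso; omega
  · -- sides 2 and 1: hub `v' + (0, D)`
    set q : Site 2 := ![v' 0 + (0), v' 1 + (D)] with hq
    have hq0 : q 0 = v' 0 + (0) := by simp [hq]
    have hq1 : q 1 = v' 1 + (D) := by simp [hq]
    have ms : s ∈ hexConvex c₂ := mem _ s (by simp only [hc₂, Matrix.cons_val_zero, Matrix.cons_val_one, Matrix.cons_val, le_min_iff]; omega)
    have mq : q ∈ hexConvex c₂ := mem _ q (by rw [hq0, hq1]; simp only [hc₂, Matrix.cons_val_zero, Matrix.cons_val_one, Matrix.cons_val, le_min_iff]; omega)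
    have mq' : q ∈ hexConvex c₁ := mem _ q (by rw [hq0, hq1]; simp only [hc₁, Matrix.cons_val_zero, Matrix.cons_val_one, Matrix.cons_val, le_min_iff]; omega)
    have ms' : s' ∈ hexConvex c₁ := mem _ s' (by simp only [hc₁, Matrix.cons_val_zero, Matrix.cons_val_one, Matrix.cons_val, le_min_iff]; omega)
    exact ((pathIn_hexConvex _ ms mq).mono sub₂).trans ((pathIn_hexConvex _ mq' ms').mono sub₁)
  · -- both on side 2
    have ms : s ∈ hexConvex c₂ := mem _ s (by simp only [hc₂, Matrix.cons_val_zero, Matrix.cons_val_one, Matrix.cons_val, le_min_iff]; omega)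
    have ms' : s' ∈ hexConvex c₂ := mem _ s' (by simp only [hc₂, Matrix.cons_val_zero, Matrix.cons_val_one, Matrix.cons_val, le_min_iff]; omega)
    exact (pathIn_hexConvex _ ms ms').mono sub₂
  · -- sides 2 and 3: hub `v' + (-D, D)`
    set q : Site 2 := ![v' 0 + (-D), v' 1 + (D)] with hq
    have hq0 : q 0 = v' 0 + (-D) := by simp [hq]
    have hq1 : q 1 = v' 1 + (D) := by simp [hq]
    have ms : s ∈ hexConvex c₂ := mem _ s (by simp only [hc₂, Matrix.cons_val_zero, Matrix.cons_val_one, Matrix.cons_val, le_min_iff]; omega)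
    have mq : q ∈ hexConvex c₂ := mem _ q (by rw [hq0, hq1]; simp only [hc₂, Matrix.cons_val_zero, Matrix.cons_val_one, Matrix.cons_val, le_min_iff]; omega)
    have mq' : q ∈ hexConvex c₃ := mem _ q (by rw [hq0, hq1]; simp only [hc₃, Matrix.cons_val_zero, Matrix.cons_val_one, Matrix.cons_val, le_min_iff]; omega)
    have ms' : s' ∈ hexConvex c₃ := mem _ s' (by simp only [hc₃, Matrix.cons_val_zero, Matrix.cons_val_one, Matrix.cons_val, le_min_iff]; omega)
    exact ((pathIn_hexConvex _ ms mq).mono sub₂).trans ((pathIn_hexConvex _ mq' ms').mono sub₃)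
  · -- sides 2 and 4 are too far apart
    exfalso; omega
  · -- sides 2 and 5 are too far apart
    exfalso; omega
  · -- sides 3 and 1 are too far apart
    exfalso; omega
  · -- sides 3 and 2: hub `v' + (-D, D)`
    set q : Site 2 := ![v' 0 + (-D), v' 1 + (D)] with hq
    have hq0 : q 0 = v' 0 + (-D) := by simp [hq]
    have hq1 : q 1 = v' 1 + (D) := by simp [hq]
    have ms : s ∈ hexConvex c₃ := mem _ s (by simp only [hc₃, Matrix.cons_val_zero, Matrix.cons_val_one, Matrix.cons_val, le_min_iff]; omega)
    have mq : q ∈ hexConvex c₃ := mem _ q (by rw [hq0, hq1]; simp only [hc₃, Matrix.cons_val_zero, Matrix.cons_val_one, Matrix.cons_val, le_min_iff]; omega)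
    have mq' : q ∈ hexConvex c₂ := mem _ q (by rw [hq0, hq1]; simp only [hc₂, Matrix.cons_val_zero, Matrix.cons_val_one, Matrix.cons_val, le_min_iff]; omega)
    have ms' : s' ∈ hexConvex c₂ := mem _ s' (by simp only [hc₂, Matrix.cons_val_zero, Matrix.cons_val_one, Matrix.cons_val, le_min_iff]; omega)
    exact ((pathIn_hexConvex _ ms mq).mono sub₃).trans ((pathIn_hexConvex _ mq' ms').mono sub₂)
  · -- both on side 3
    have ms : s ∈ hexConvex c₃ := mem _ s (by simp only [hc₃, Matrix.cons_val_zero, Matrix.cons_val_one, Matrix.cons_val, le_min_iff]; omega)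
    have ms' : s' ∈ hexConvex c₃ := mem _ s' (by simp only [hc₃, Matrix.cons_val_zero, Matrix.cons_val_one, Matrix.cons_val, le_min_iff]; omega)
    exact (pathIn_hexConvex _ ms ms').mono sub₃
  · -- sides 3 and 4: hub `v' + (-D, 0)`
    set q : Site 2 := ![v' 0 + (-D), v' 1 + (0)] with hq
    have hq0 : q 0 = v' 0 + (-D) := by simp [hq]
    have hq1 : q 1 = v' 1 + (0) := by simp [hq]
    have ms : s ∈ hexConvex c₃ := mem _ s (by simp only [hc₃, Matrix.cons_val_zero, Matrix.cons_val_one, Matrix.cons_val, le_min_iff]; omega)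
    have mq : q ∈ hexConvex c₃ := mem _ q (by rw [hq0, hq1]; simp only [hc₃, Matrix.cons_val_zero, Matrix.cons_val_one, Matrix.cons_val, le_min_iff]; omega)
    have mq' : q ∈ hexConvex c₄ := mem _ q (by rw [hq0, hq1]; simp only [hc₄, Matrix.cons_val_zero, Matrix.cons_val_one, Matrix.cons_val, le_min_iff]; omega)
    have ms' : s' ∈ hexConvex c₄ := mem _ s' (by simp only [hc₄, Matrix.cons_val_zero, Matrix.cons_val_one, Matrix.cons_val, le_min_iff]; omega)
    exact ((pathIn_hexConvex _ ms mq).mono sub₃).trans ((pathIn_hexConvex _ mq' ms').mono sub₄)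
  · -- sides 3 and 5 are too far apart
    exfalso; omega
  · -- sides 4 and 1 are too far apart
    exfalso; omega
  · -- sides 4 and 2 are too far apart
    exfalso; omega
  · -- sides 4 and 3: hub `v' + (-D, 0)`
    set q : Site 2 := ![v' 0 + (-D), v' 1 + (0)] with hq
    have hq0 : q 0 = v' 0 + (-D) := by simp [hq]
    have hq1 : q 1 = v' 1 + (0) := by simp [hq]
    have ms : s ∈ hexConvex c₄ := mem _ s (by simp only [hc₄, Matrix.cons_val_zero, Matrix.cons_val_one, Matrix.cons_val, le_min_iff]; omega)
    have mq : q ∈ hexConvex c₄ := mem _ q (by rw [hq0, hq1]; simp only [hc₄, Matrix.cons_val_zero, Matrix.cons_val_one, Matrix.cons_val, le_min_iff]; omega)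
    have mq' : q ∈ hexConvex c₃ := mem _ q (by rw [hq0, hq1]; simp only [hc₃, Matrix.cons_val_zero, Matrix.cons_val_one, Matrix.cons_val, le_min_iff]; omega)
    have ms' : s' ∈ hexConvex c₃ := mem _ s' (by simp only [hc₃, Matrix.cons_val_zero, Matrix.cons_val_one, Matrix.cons_val, le_min_iff]; omega)
    exact ((pathIn_hexConvex _ ms mq).mono sub₄).trans ((pathIn_hexConvex _ mq' ms').mono sub₃)
  · -- both on side 4
    have ms : s ∈ hexConvex c₄ := mem _ s (by simp only [hc₄, Matrix.cons_val_zero, Matrix.cons_val_one, Matrix.cons_val, le_min_iff]; omega)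
    have ms' : s' ∈ hexConvex c₄ := mem _ s' (by simp only [hc₄, Matrix.cons_val_zero, Matrix.cons_val_one, Matrix.cons_val, le_min_iff]; omega)
    exact (pathIn_hexConvex _ ms ms').mono sub₄
  · -- sides 4 and 5: hub `v' + (0, -D)`
    set q : Site 2 := ![v' 0 + (0), v' 1 + (-D)] with hq
    have hq0 : q 0 = v' 0 + (0) := by simp [hq]
    have hq1 : q 1 = v' 1 + (-D) := by simp [hq]
    have ms : s ∈ hexConvex c₄ := mem _ s (by simp only [hc₄, Matrix.cons_val_zero, Matrix.cons_val_one, Matrix.cons_val, le_min_iff]; omega)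
    have mq : q ∈ hexConvex c₄ := mem _ q (by rw [hq0, hq1]; simp only [hc₄, Matrix.cons_val_zero, Matrix.cons_val_one, Matrix.cons_val, le_min_iff]; omega)
    have mq' : q ∈ hexConvex c₅ := mem _ q (by rw [hq0, hq1]; simp only [hc₅, Matrix.cons_val_zero, Matrix.cons_val_one, Matrix.cons_val, le_min_iff]; omega)
    have ms' : s' ∈ hexConvex c₅ := mem _ s' (by simp only [hc₅, Matrix.cons_val_zero, Matrix.cons_val_one, Matrix.cons_val, le_min_iff]; omega)
    exact ((pathIn_hexConvex _ ms mq).mono sub₄).trans ((pathIn_hexConvex _ mq' ms').mono sub₅)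
  · -- sides 5 and 1 are too far apart
    exfalso; omega
  · -- sides 5 and 2 are too far apart
    exfalso; omega
  · -- sides 5 and 3 are too far apart
    exfalso; omega
  · -- sides 5 and 4: hub `v' + (0, -D)`
    set q : Site 2 := ![v' 0 + (0), v' 1 + (-D)] with hq
    have hq0 : q 0 = v' 0 + (0) := by simp [hq]
    have hq1 : q 1 = v' 1 + (-D) := by simp [hq]
    have ms : s ∈ hexConvex c₅ := mem _ s (by simp only [hc₅, Matrix.cons_val_zero, Matrix.cons_val_one, Matrix.cons_val, le_min_iff]; omega)
    have mq : q ∈ hexConvex c₅ := mem _ q (by rw [hq0, hq1]; simp only [hc₅, Matrix.cons_val_zero, Matrix.cons_val_one, Matrix.cons_val, le_min_iff]; omega)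
    have mq' : q ∈ hexConvex c₄ := mem _ q (by rw [hq0, hq1]; simp only [hc₄, Matrix.cons_val_zero, Matrix.cons_val_one, Matrix.cons_val, le_min_iff]; omega)
    have ms' : s' ∈ hexConvex c₄ := mem _ s' (by simp only [hc₄, Matrix.cons_val_zero, Matrix.cons_val_one, Matrix.cons_val, le_min_iff]; omega)
    exact ((pathIn_hexConvex _ ms mq).mono sub₅).trans ((pathIn_hexConvex _ mq' ms').mono sub₄)
  · -- both on side 5
    have ms : s ∈ hexConvex c₅ := mem _ s (by simp only [hc₅, Matrix.cons_val_zero, Matrix.cons_val_one, Matrix.cons_val, le_min_iff]; omega)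
    have ms' : s' ∈ hexConvex c₅ := mem _ s' (by simp only [hc₅, Matrix.cons_val_zero, Matrix.cons_val_one, Matrix.cons_val, le_min_iff]; omega)
    exact (pathIn_hexConvex _ ms ms').mono sub₅

/-- **The unpainted exterior inside the punctured ball is connected.** If `|e + v| = |e' + v| = N + 1`,
`e + v, e' + v ∉ sidePaint N i` (`i ≤ 6`), `|e|, |e'| ≤ D`, `4D + 1 ≤ N + 1` and `|v| ≤ N`, then
`e, e'` are joined by a path of sites `u` with `N < |u + v|`, `u + v` unpainted, `1 ≤ |u| ≤ D`
(`exterior_pathIn_frame0` in the frame of side `i`). [folklore] -/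
theorem pathIn_exterior_ball (hi : i ≤ 6) (hvN : triNorm v ≤ N) (hND : 4 * D + 1 ≤ N + 1)
    {e e' : Site 2} (he : triNorm (e + v) = (N : ℤ) + 1) (he' : triNorm (e' + v) = (N : ℤ) + 1)
    (heP : e + v ∉ sidePaint N i) (heP' : e' + v ∉ sidePaint N i) (hD : triNorm e ≤ D)
    (hD' : triNorm e' ≤ D) :
    PathIn triGraph {z : Site 2 | (N : ℤ) < triNorm (z + v) ∧ z + v ∉ sidePaint N i ∧
      1 ≤ triNorm z ∧ triNorm z ≤ D} e e' := by
  set v' := triRotIsoPow (6 - i) v with hv'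
  set s := triRotIsoPow (6 - i) (e + v) with hs
  set s' := triRotIsoPow (6 - i) (e' + v) with hs'
  have hvn : triNorm v' = triNorm v := triNorm_rot _ _
  have hsv : s - v' = triRotIsoPow (6 - i) e := by rw [hs, hv', ← triRotIsoPow_apply_sub, add_sub_cancel_right]
  have hsv' : s' - v' = triRotIsoPow (6 - i) e' := by rw [hs', hv', ← triRotIsoPow_apply_sub, add_sub_cancel_right]
  have hsD : triNorm (s - v') ≤ D := by rw [hsv, triNorm_rot]; exact hD
  have hsD' : triNorm (s' - v') ≤ D := by rw [hsv', triNorm_rot]; exact hD'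
  have hsn : triNorm s = ((N + 1 : ℕ) : ℤ) := by rw [hs, triNorm_rot, he]; push_cast; ring
  have hsn' : triNorm s' = ((N + 1 : ℕ) : ℤ) := by rw [hs', triNorm_rot, he']; push_cast; ring
  have hsc : ¬ (0 < s 0 ∧ s 1 < 0 ∧ 0 < s 0 + s 1) := by
    intro hc
    exact heP ((mem_sidePaint_iff_rot hi).2 ⟨by rw [← hs, hsn]; push_cast; omega, by rw [← hs]; exact hc⟩)
  have hsc' : ¬ (0 < s' 0 ∧ s' 1 < 0 ∧ 0 < s' 0 + s' 1) := by
    intro hc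
    exact heP' ((mem_sidePaint_iff_rot hi).2 ⟨by rw [← hs', hsn']; push_cast; omega, by rw [← hs']; exact hc⟩)
  have hpath0 := exterior_pathIn_frame0 (M := N + 1) (D := D) (v' := v') hND
    (by rw [hvn]; push_cast; omega) hsn hsn' hsc hsc' hsD hsD'
  have hpath := pathIn_map_iso (frameBack i v) hpath0
  rw [hs, hs', frameBack_rot hi, frameBack_rot hi] at hpath
  refine hpath.mono ?_
  rintro z ⟨w, ⟨hwM, hwc, hwD⟩, rfl⟩
  refine ⟨?_, ?_, ?_, by rw [triNorm_frameBack]; exact hwD⟩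
  · rw [frameBack_add hi, triNorm_rot]; push_cast at hwM; omega
  · rw [frameBack_add hi, mem_sidePaint_iff_rot hi, triRotIsoPow_sub_six_apply hi]
    exact fun h => hwc h.2
  · rw [triNorm_frameBack, ← hv']
    have h1 := triNorm_add_le (w - v') v'
    rw [sub_add_cancel] at h1
    push_cast at hwM
    omega

end Frame

end Literature.Probability.Percolation
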